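/-
Copyright (c) 2026 the pub-hodgecm-mathlib formalisation cell (harness21).  Prover seat hodgecm-mathlib-LH7-p08 (g3), req620 Track A «(D-RAM) FOUR-FRAME» squad
(STAGE-1b, row (2) of the piece `f_{T₊}`, the (β₂) road (R-36) «PURE-CELL LEDGER», K6 road; β₂ sub-dealer LH4-p04 (g10) WORD #37 «the lane-B digit dictionary K6-(d)
(LH7-p08 (g3)): which `Rd`-shell is cell `j − b`», K6-ROAD-BRIEF v1 dfa84314 §2 row K6-(d); the lane-B twin of LH4-p16 (g2) MECH-K3 d766981c §1), 2026-09-05.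
-/
import Summits.HodgeConjecture.HodgeConjecture.Theorems.F0P3cDyRamDiagonalCellCoordinates   -- ★ (LH4-p19 (g2), lane B (L-D♭) K3): `theta0_letters` (the pivot `θ₀ = αΘα`); brings ★ `…DiagonalCellLiteralDigits.hatw_add_map_hatw`, ★ DEFS
import Summits.HodgeConjecture.HodgeConjecture.Theorems.F0P3cDyRamSphereCellGenerator      -- ★ (LH4-p15 (g2)): `one_le_v_of_trace_one` (`Tr_ρ κ = 1 ⇒ 1 ≤ |κ|`, any lane)
import HarnessLib

/-!
# Crux `H413`, line LH4 «(D-RAM) FOUR-FRAME» — STAGE-1b, row (2), the (β₂) road (R-36), K6-(d): «THE LANE-B DIGIT-SHELL DICTIONARY» — on the line `{Tr_ρ = 1} ∩ Fix Θ` of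
# type RamK the point `κ₀ + W·ξ₀` over a size-one base point has size `max 1 (|W|·|ξ₀|)`; hence the sphere clause of the count socket's literal predicate is AUTOMATIC on the
# diagonal (radius-one) cell and reads `|V₀| = 1` on a tower cell whose direction `ξ₀` has the cell's radius; odd cell indices `j − b` carry no point of the line

Cell `hodgecm-mathlib` (D-0151), FLOOR 0, crux item H413 = `stmt-HodgeConjecture-24833`, route of record `HCCMUnconditional`; squad F0∕P3c∕LH7 (hand lent to the LH4 β₂ board);
lane `--supports stmt-HodgeConjecture-24833 --as helper` (count-neutral; pays NO tier-0 row).  THEOREMS ONLY (no `def`, no instance, no notation, no `sorry`, default heartbeats);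
★-only imports; states NO law; (β₂) stays a HYPOTHESIS.  DATUM-LIGHT two-field letters (`jE : E → M` isometric with `Fix ρ ⊇ jE(E)`; `ρ` isometric; `Θ` commuting with `ρ`); the
only datum clause used is «`Θ`-fixed non-zero elements have valuation in `exp(2ℤ)`» of `IsRamifiedQuadraticDatum Θ (jE ϖ) d tE` (§5).

WHAT (K6-ROAD-BRIEF v1 §2 row K6-(d); β₂ WORD #37).  LH4-p19 (g2)'s count sockets ★ p863807 ∕ ★ p863833 and LH4-p18 (g4)'s per-cell law K6-0 run on ABSTRACT letters
`Vf, Rd, LIT, r`; the ★ reads instantiate `Vf x₀ = (κ̂(x₀) − κ₀) ∕ ξ₀` (★ p863914) for a reference pair `(κ₀, ξ₀)` of the cell (`Tr_ρ κ₀ = 1`, `Θκ₀ = κ₀`, `ρξ₀ = −ξ₀`, `Θξ₀ = ξ₀ ≠ 0`)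
and the literal predicate `LIT V₀ :≡ SPHERE ∧ CLASS` (★ p863983) with
  `SPHERE V₀ :≡ |κ₀ + jE V₀·ξ₀| · |jE ϖ^j·(α − ρα)| = |jE ϖ|^b`     (the digit `κ₀ + jE V₀·ξ₀` has the cell's digit radius `R(j, b) = |ϖE|^b ∕ |ϖE^j (α − ρα)|`).
To EVALUATE `Rd.filter LIT` (the ‹FLIPT.v1› payer cross-multiplies two K6-0 instances, LH4-p18 (g4); the CORE assembler sums over all cells, heir LH4-p16 ∕ LH7-p06 (g3)) one needs,
per cell index `j − b`, WHICH digits satisfy SPHERE.  In lane B (type RamK: `|α − ρα| = 1` (`_hU`), `|α − Θα| < 1` (`_hτ`), `|2| < 1`; `Θ`-fixed valuations even (`_hDM`)):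
* §1 THE DICTIONARY (lane-free algebra): for a point `κ₀` of `ρ`-trace one and SIZE ONE, a `ρ`-anti `ξ₀` and a `ρ`-fixed `W`: **`|κ₀ + W·ξ₀| = max 1 (|W|·|ξ₀|)`** — the upper bound is
  ultrametric, the lower bound is ★ `one_le_v_of_trace_one` (`κ₀ + Wξ₀` again has trace one), the strict case `|Wξ₀| > 1` is exact.  So in a GLOBAL frame with `|κ₀| = |ξ₀| = 1` the
  cell of the digit with coordinate `W` is `j − b = 0 ↔ |W| ≤ 1` — the WHOLE unit ball: lane C's bottom ball `D` and unit shell `K₀` (MECH-K3 §1, `|κ_min| > 1` there) MERGE in lane B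
  (`|κ_min| = 1`) — and `j − b = 2i ↔ |W| = exp 2i` (the tower `T_i` is the shell); odd `j − b` is EMPTY (§5).
* §2 `radius_letters`: `|jE ϖ^j (α − ρα)| = exp(−j)`, `|jE ϖ|^b = exp(−b)` (so `R(j, b) = exp(j − b)`; radius one iff `j = b`).
* §3 HEAD-D `sphereClause_of_radius_one` ∕ `sphereClause_diag`: on a radius-one cell, with `|κ₀| = 1`, `|ξ₀| ≤ 1`, SPHERE HOLDS at every integral digit `|V₀| ≤ 1`; Finset form
  `filter_sphere_and_eq_filter_of_radius_one`: `Rd.filter (SPHERE ∧ C) = Rd.filter C` for any digit system of integral digits and any class predicate `C`.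
* §4 HEAD-T `sphereClause_iff_v_eq_one_of_lt` ∕ `sphereClause_tower_iff`: on a cell `b + c = j`, `1 ≤ c`, with `|κ₀| < |ξ₀|` and `ξ₀` OF THE CELL'S RADIUS (`|ξ₀| = exp c` when
  `|κ₀| = 1`), SPHERE ⟺ `|V₀| = 1` (pure ultrametric); Finset form `filter_sphere_and_eq_filter_shell`: `Rd.filter (SPHERE ∧ C) = (Rd.filter (|·| = 1)).filter C`.
* §5 `exists_eq_add_two_mul_of_sphereClause`: a `Θ`-fixed trace-one point satisfying SPHERE at `(j, b)` forces `j = b + 2n` (`|κ| = exp(j − b) ∈ exp(2ℤ)`, `≥ 1`).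
* §6 THE LANE-B PIVOT PAIR, MEMBER-FREE: from ★ `theta0_letters` (`θ₀ = αΘα` is `Θ`-fixed, integral, `|θ₀ − ρθ₀| = 1`) the pair `κ_θ := −ρθ₀ ∕ (θ₀ − ρθ₀)`, `ξ_θ := (θ₀ − ρθ₀)⁻¹`
  has all seven reference-pair letters WITH `|κ_θ| = |ξ_θ| = 1` (`pivotPair_letters`, `pivotPair_of_frame`), and LH4-p19's diagonal-cell coordinate `ŵ(V) = (V − ρθ₀) ∕ (θ₀ − ρθ₀)`
  (★ `hatw_add_map_hatw`) IS `κ_θ + V·ξ_θ`; `towerDirection_letters`: `ξ := jE(((ϖσϖ)⁻¹)^i)·ξ₀` is again `ρ`-anti, `Θ`-fixed, non-zero, of size `exp(2i)·|ξ₀|` — the direction of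
  the radius of the tower cell `j = b + 2i` over the unit pair.
* §7 ONE CHART FOR THE WHOLE ROW (K6-(e) instantiation of ★ `…CoreWindowOfDigitSums` §2′ and ‹K6-(f)›, which need ONE digit set `B`: β₂ WORD #38, LH7-p06 (g3) SIG-K6f §2, LH4-p04
  01:47Z (1)): with ONE pair `|κ₀| = 1`, `ρξ₀ = −ξ₀` of ANY size (the top tower's radius `exp 2N`): `sphereClause_iff_max_eq` — SPHERE of `(j, b)` at `V₀` ⟺ `max 1 (|V₀|·|ξ₀|) =
  exp(j − b)` (so `cell V₀ = log max 1 (|V₀|·|ξ₀|)`); `sphereClause_oneChart_diag_iff` (`j = b` ⟺ `|V₀|·|ξ₀| ≤ 1`), `sphereClause_oneChart_tower_iff` (`b < j` ⟺ `|V₀|·|ξ₀| = exp(j − b)`);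
  `eq_of_sphereClause_of_sphereClause` (the cells are DISJOINT) and `exists_sphereClause_of_oneChart` (with `|ξ₀| = exp 2N` every `σ`-fixed integral digit lies in some cell `b + 2i`,
  `i ≤ N` — the cells COVER `Rd`; `σ`-fixed valuations are even, `_hD`).
WHAT IS NOT CLAIMED: the CLASS conjunct of `LIT` (★ p863983 ∕ ★ p863710), the conductor shell of the label character per cell and the character-sum values (K6-(e); ★ LH4-p14),
(hI)(hV)(hP)(hF) (★), any count, the ‹FLIPT.v1› cross-multiplication (LH4-p18 (g4)); lane C (MECH-K3 §1) and lane A are not touched.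
HONEST LABEL.  Count-neutral valuation bookkeeping; nothing printed is asserted; no census law is stated; `HC_CM` is proved only modulo the 7 printed citations (2 remaining named
inputs: hLiu418 = `stmt-HodgeConjecture-24832`, h413 = `stmt-HodgeConjecture-24833`) until rung 0 closes.
## References
* [Serre1979] J.-P. Serre, *Local Fields*, GTM 67 (1979): Ch. II §1 (ultrametric inequality, equality case), Ch. V §2 Prop. 3 p. 81 (unramified quadratic: basis `{1, θ}`, trace), Ch. III §6 Prop. 12.
* [Flicker1998UnitaryFL] Y. Z. Flicker, *Elementary proof of the fundamental lemma for a unitary group*, Canad. J. Math. 50 (1998): Prop. 7 p. 84 (torus-orbit census, type RamK: strata by one valuation).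
* [Kottwitz1986BaseChangeUnits] R. E. Kottwitz, *Base change for unit elements of Hecke algebras*, Compositio Math. 60 (1986): §1 pp. 240–241 (fixed-lattice counts as orbital integrals).
* [Rogawski1990] J. D. Rogawski, *Automorphic Representations of Unitary Groups in Three Variables*, Ann. of Math. Stud. 123 (1990): §4.9 Prop. 4.9.1 (b) p. 55 (the labelled census).
-/

set_option autoImplicit false

noncomputable section

namespace Summit.HodgeConjecture.HodgeConjecture.Cruxes.H413.F0P3cDyRamRowCellDigitShellDictionary

open scoped Valued WithZero
open WithZero Finset
open Literature.NumberTheory.Automorphic.UnitaryThreeFourFrame (IsRamifiedQuadraticDatum)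
open Summit.HodgeConjecture.HodgeConjecture.Cruxes.H413.F0P3cDyRamSphereCellGenerator (one_le_v_of_trace_one)
open Summit.HodgeConjecture.HodgeConjecture.Cruxes.H413.F0P3cDyRamDiagonalCellCoordinates (theta0_letters)

variable {E M : Type} [Field E] [Valued E ℤᵐ⁰] [Field M] [Valued M ℤᵐ⁰] {ρ Θ : M →+* M} {α : M}

/-! ## §1 The dictionary: a size-one point of `ρ`-trace one plus a `ρ`-anti multiple -/

omit [Field E] [Valued E ℤᵐ⁰] in
/-- **THE DIGIT-SHELL DICTIONARY (lane-free algebra).**  `ρ` isometric; `κ₀ + ρκ₀ = 1` with `|κ₀| = 1`; `ρξ₀ = −ξ₀`; `ρW = W`.  THEN `|κ₀ + W·ξ₀| = max 1 (|W|·|ξ₀|)`: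
`κ₀ + Wξ₀` has `ρ`-trace one, so `1 ≤ |κ₀ + Wξ₀|` (★ `one_le_v_of_trace_one`); `|κ₀ + Wξ₀| ≤ max |κ₀| |Wξ₀|`; and for `|Wξ₀| > 1 = |κ₀|` the ultrametric inequality is an equality.
(In lane B with `|ξ₀| = 1`: cell index `0 ↔ |W| ≤ 1`, the whole unit ball; `2i ↔ |W| = exp 2i`.) [cite: Serre1979, Ch. II §1; Ch. V §2 Prop. 3 p. 81] [cite: Flicker1998UnitaryFL, Prop. 7 p. 84] -/
theorem v_traceOne_add_mul_anti_eq_max (hvρ : ∀ x, Valued.v (ρ x) = Valued.v x)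
    {κ₀ ξ₀ W : M} (hκ₀ : κ₀ + ρ κ₀ = 1) (hκ₀1 : Valued.v κ₀ = 1) (hξ : ρ ξ₀ = -ξ₀) (hW : ρ W = W) :
    Valued.v (κ₀ + W * ξ₀) = max 1 (Valued.v W * Valued.v ξ₀) := by
  have htr : (κ₀ + W * ξ₀) + ρ (κ₀ + W * ξ₀) = 1 := by
    rw [map_add, map_mul, hW, hξ]; linear_combination hκ₀
  have hge : 1 ≤ Valued.v (κ₀ + W * ξ₀) := one_le_v_of_trace_one hvρ htr
  rcases le_or_gt (Valued.v W * Valued.v ξ₀) 1 with h | h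
  · rw [max_eq_left h]
    refine le_antisymm ((Valuation.map_add _ _ _).trans (max_le hκ₀1.le ?_)) hge
    rw [Valuation.map_mul]; exact h
  · rw [max_eq_right h.le]
    have hlt : Valued.v κ₀ < Valued.v (W * ξ₀) := by rw [hκ₀1, Valuation.map_mul]; exact h
    rw [Valuation.map_add_eq_of_lt_right _ hlt, Valuation.map_mul]

/-- **THE DICTIONARY IN `E`-COORDINATES**: `jE : E → M` with `ρ ∘ jE = jE` and `|jE a| = |a|`; `κ₀ + ρκ₀ = 1`, `|κ₀| = 1`, `ρξ₀ = −ξ₀`.  THEN for every `V₀ : E`: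
`|κ₀ + jE V₀·ξ₀| = max 1 (|V₀|·|ξ₀|)`. [cite: Serre1979, Ch. II §1; Ch. V §2 Prop. 3 p. 81] -/
theorem v_traceOne_add_map_mul_anti_eq_max (hvρ : ∀ x, Valued.v (ρ x) = Valued.v x) (jE : E →+* M) (hρj : ∀ c, ρ (jE c) = jE c)
    (hjiso : ∀ a, Valued.v (jE a) = Valued.v a) {κ₀ ξ₀ : M} (hκ₀ : κ₀ + ρ κ₀ = 1) (hκ₀1 : Valued.v κ₀ = 1) (hξ : ρ ξ₀ = -ξ₀) (V₀ : E) :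
    Valued.v (κ₀ + jE V₀ * ξ₀) = max 1 (Valued.v V₀ * Valued.v ξ₀) := by
  rw [v_traceOne_add_mul_anti_eq_max hvρ hκ₀ hκ₀1 hξ (hρj V₀), hjiso]

/-! ## §2 The radius letters of the cell `(j, b)` in lane B -/

omit [Valued E ℤᵐ⁰] in
/-- **THE RADIUS LETTERS (lane B).**  `|jE a| = |a|`, `|ϖ| = exp(−1)`, `|α − ρα| = 1` (`_hU`).  THEN `|jE ϖ^j·(α − ρα)| = exp(−j)` and `|jE ϖ|^b = exp(−b)` — the digit radius of the
cell `(j, b)` is `exp(j − b)`, equal to `1` iff `j = b`. [cite: Serre1979, Ch. II §1] -/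
theorem radius_letters [Valued E ℤᵐ⁰] (jE : E →+* M) (hjiso : ∀ a, Valued.v (jE a) = Valued.v a) {ϖ : E} (hϖ : Valued.v ϖ = exp (-1 : ℤ))
    (hU : Valued.v (α - ρ α) = 1) (j b : ℕ) :
    Valued.v (jE ϖ ^ j * (α - ρ α)) = exp (-(j : ℤ)) ∧ Valued.v (jE ϖ) ^ b = exp (-(b : ℤ)) := by
  have hjϖ : Valued.v (jE ϖ) = exp (-1 : ℤ) := by rw [hjiso, hϖ]
  refine ⟨?_, ?_⟩
  · rw [Valuation.map_mul, Valuation.map_pow, hjϖ, hU, mul_one, ← exp_nsmul, nsmul_eq_mul, mul_neg, mul_one]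
  · rw [hjϖ, ← exp_nsmul, nsmul_eq_mul, mul_neg, mul_one]

/-! ## §3 HEAD-D — the diagonal (radius-one) cell: the sphere clause holds at every integral digit -/

/-- **HEAD-D — THE SPHERE CLAUSE IS AUTOMATIC ON A RADIUS-ONE CELL.**  `ρ` isometric, `jE`-letters (`ρ ∘ jE = jE`, `|jE a| = |a|`); the cell `(j, b)` has digit radius one
(`hR1 : |jE ϖ^j (α − ρα)| = |jE ϖ|^b`, i.e. `j = b` under `_hU`, §2); a reference pair with `κ₀ + ρκ₀ = 1`, `|κ₀| = 1`, `ρξ₀ = −ξ₀`, `|ξ₀| ≤ 1` (the pivot pair of §6).  THEN for every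
integral digit `|V₀| ≤ 1` the sphere conjunct of ★ p863983's `LIT V₀` HOLDS: `|κ₀ + jE V₀·ξ₀| · |jE ϖ^j (α − ρα)| = |jE ϖ|^b`.  (§1: `|κ₀ + jE V₀ ξ₀| = max 1 (|V₀||ξ₀|) = 1`.)
[cite: Serre1979, Ch. II §1; Ch. V §2 Prop. 3 p. 81] [cite: Flicker1998UnitaryFL, Prop. 7 p. 84] [cite: Kottwitz1986BaseChangeUnits, §1 pp. 240–241] -/
theorem sphereClause_of_radius_one (hvρ : ∀ x, Valued.v (ρ x) = Valued.v x) (jE : E →+* M) (hρj : ∀ c, ρ (jE c) = jE c)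
    (hjiso : ∀ a, Valued.v (jE a) = Valued.v a) {ϖ : E} {j b : ℕ}
    (hR1 : Valued.v (jE ϖ ^ j * (α - ρ α)) = Valued.v (jE ϖ) ^ b)
    {κ₀ ξ₀ : M} (hκ₀ : κ₀ + ρ κ₀ = 1) (hκ₀1 : Valued.v κ₀ = 1) (hξ : ρ ξ₀ = -ξ₀) (hξ1 : Valued.v ξ₀ ≤ 1)
    {V₀ : E} (hV₀ : Valued.v V₀ ≤ 1) :
    Valued.v (κ₀ + jE V₀ * ξ₀) * Valued.v (jE ϖ ^ j * (α - ρ α)) = Valued.v (jE ϖ) ^ b := by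
  rw [v_traceOne_add_map_mul_anti_eq_max hvρ jE hρj hjiso hκ₀ hκ₀1 hξ V₀, max_eq_left (mul_le_one' hV₀ hξ1), one_mul, hR1]

/-- **HEAD-D FOR THE DIAGONAL CELL `(b, b)` OF ‹FLIPT.v1› ∕ ‹HFT.v2›** (`cell = levelSetDep ρ Θ α (jE ϖ) h b b (lam − jE u)`): `|ϖ| = exp(−1)`, `|α − ρα| = 1` (`_hU`); a reference
pair with `κ₀ + ρκ₀ = 1`, `|κ₀| = 1`, `ρξ₀ = −ξ₀`, `|ξ₀| ≤ 1`.  THEN for every `|V₀| ≤ 1`: `|κ₀ + jE V₀·ξ₀| · |jE ϖ^b (α − ρα)| = |jE ϖ|^b`.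
[cite: Serre1979, Ch. II §1; Ch. V §2 Prop. 3 p. 81] [cite: Flicker1998UnitaryFL, Prop. 7 p. 84] -/
theorem sphereClause_diag (hvρ : ∀ x, Valued.v (ρ x) = Valued.v x) (jE : E →+* M) (hρj : ∀ c, ρ (jE c) = jE c)
    (hjiso : ∀ a, Valued.v (jE a) = Valued.v a) {ϖ : E} (hϖ : Valued.v ϖ = exp (-1 : ℤ)) (hU : Valued.v (α - ρ α) = 1) (b : ℕ)
    {κ₀ ξ₀ : M} (hκ₀ : κ₀ + ρ κ₀ = 1) (hκ₀1 : Valued.v κ₀ = 1) (hξ : ρ ξ₀ = -ξ₀) (hξ1 : Valued.v ξ₀ ≤ 1)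
    {V₀ : E} (hV₀ : Valued.v V₀ ≤ 1) :
    Valued.v (κ₀ + jE V₀ * ξ₀) * Valued.v (jE ϖ ^ b * (α - ρ α)) = Valued.v (jE ϖ) ^ b := by
  obtain ⟨h1, h2⟩ := radius_letters (ρ := ρ) jE hjiso hϖ hU b b
  exact sphereClause_of_radius_one hvρ jE hρj hjiso (by rw [h1, h2]) hκ₀ hκ₀1 hξ hξ1 hV₀

/-- **HEAD-D, FINSET FORM — `Rd.filter LIT = Rd.filter CLASS` ON A RADIUS-ONE CELL.**  Frame of `sphereClause_of_radius_one`; a digit system `Rd` of INTEGRAL digits and any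
class predicate `C`.  THEN `Rd.filter (fun V ↦ SPHERE V ∧ C V) = Rd.filter C` — the literal digits of the diagonal cell are ALL class digits of the unit ball (K6-0's
`#(Rd.filter LIT)` and `Σ_{(Rd.filter LIT).filter NX}` are sums over `Rd.filter CLASS`). [cite: Serre1979, Ch. V §2 Prop. 3 p. 81] [cite: Kottwitz1986BaseChangeUnits, §1 pp. 240–241] -/
theorem filter_sphere_and_eq_filter_of_radius_one (hvρ : ∀ x, Valued.v (ρ x) = Valued.v x) (jE : E →+* M) (hρj : ∀ c, ρ (jE c) = jE c)
    (hjiso : ∀ a, Valued.v (jE a) = Valued.v a) {ϖ : E} {j b : ℕ}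
    (hR1 : Valued.v (jE ϖ ^ j * (α - ρ α)) = Valued.v (jE ϖ) ^ b)
    {κ₀ ξ₀ : M} (hκ₀ : κ₀ + ρ κ₀ = 1) (hκ₀1 : Valued.v κ₀ = 1) (hξ : ρ ξ₀ = -ξ₀) (hξ1 : Valued.v ξ₀ ≤ 1)
    (Rd : Finset E) (hRd1 : ∀ V ∈ Rd, Valued.v V ≤ 1) (C : E → Prop) [DecidablePred C]
    [DecidablePred fun V => Valued.v (κ₀ + jE V * ξ₀) * Valued.v (jE ϖ ^ j * (α - ρ α)) = Valued.v (jE ϖ) ^ b ∧ C V] :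
    Rd.filter (fun V => Valued.v (κ₀ + jE V * ξ₀) * Valued.v (jE ϖ ^ j * (α - ρ α)) = Valued.v (jE ϖ) ^ b ∧ C V) = Rd.filter C := by
  refine Finset.filter_congr fun V hV => ?_
  exact ⟨fun h => h.2, fun h => ⟨sphereClause_of_radius_one hvρ jE hρj hjiso hR1 hκ₀ hκ₀1 hξ hξ1 (hRd1 V hV), h⟩⟩

/-! ## §4 HEAD-T — a tower cell: with `|κ₀| < |ξ₀|` and `ξ₀` of the cell's radius the sphere clause reads `|V₀| = 1` -/

omit [Valued E ℤᵐ⁰] in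
/-- **HEAD-T — THE SPHERE CLAUSE OF A TOWER CELL IS `|V₀| = 1`.**  `|jE a| = |a|`; the cell `(j, b)` with `cc = jE ϖ^j (α − ρα) ≠ 0`; a reference pair with `|κ₀| < |ξ₀|` and
`ξ₀` OF THE CELL'S DIGIT RADIUS (`hξR : |ξ₀|·|cc| = |jE ϖ|^b`).  THEN for every integral digit `|V₀| ≤ 1`: `|κ₀ + jE V₀·ξ₀|·|cc| = |jE ϖ|^b ⟺ |V₀| = 1` (pure ultrametric: for
`|V₀| = 1` the term `jE V₀·ξ₀` dominates `κ₀`; for `|V₀| < 1` both terms are `< |ξ₀|`). [cite: Serre1979, Ch. II §1] [cite: Flicker1998UnitaryFL, Prop. 7 p. 84] -/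
theorem sphereClause_iff_v_eq_one_of_lt [Valued E ℤᵐ⁰] (jE : E →+* M) (hjiso : ∀ a, Valued.v (jE a) = Valued.v a) {ϖ : E} {j b : ℕ}
    (hcc : jE ϖ ^ j * (α - ρ α) ≠ 0) {κ₀ ξ₀ : M} (hlt : Valued.v κ₀ < Valued.v ξ₀)
    (hξR : Valued.v ξ₀ * Valued.v (jE ϖ ^ j * (α - ρ α)) = Valued.v (jE ϖ) ^ b)
    {V₀ : E} (hV₀ : Valued.v V₀ ≤ 1) :
    Valued.v (κ₀ + jE V₀ * ξ₀) * Valued.v (jE ϖ ^ j * (α - ρ α)) = Valued.v (jE ϖ) ^ b ↔ Valued.v V₀ = 1 := by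
  have hccne : Valued.v (jE ϖ ^ j * (α - ρ α)) ≠ 0 := (Valuation.ne_zero_iff _).2 hcc
  have hξpos : 0 < Valued.v ξ₀ := lt_of_le_of_lt zero_le hlt
  rw [← hξR, mul_left_inj' hccne]
  constructor
  · intro h
    by_contra hne
    have hlt1 : Valued.v V₀ < 1 := lt_of_le_of_ne hV₀ hne
    have h1 : Valued.v (jE V₀ * ξ₀) < Valued.v ξ₀ := by
      rw [Valuation.map_mul, hjiso]
      calc Valued.v V₀ * Valued.v ξ₀ < 1 * Valued.v ξ₀ := mul_lt_mul_of_pos_right hlt1 hξpos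
        _ = Valued.v ξ₀ := one_mul _
    exact (Valuation.map_add_lt _ hlt h1).ne h
  · intro h1
    have hgt : Valued.v κ₀ < Valued.v (jE V₀ * ξ₀) := by rw [Valuation.map_mul, hjiso, h1, one_mul]; exact hlt
    rw [Valuation.map_add_eq_of_lt_right _ hgt, Valuation.map_mul, hjiso, h1, one_mul]

/-- **HEAD-T FOR THE TOWER CELL `(j, b)`, `b + c = j`, `1 ≤ c`, OF ‹FLIPT.v1› ∕ ‹HFT.v2›** (`|ϖ| = exp(−1)`, `|α − ρα| = 1`): a reference pair with `|κ₀| = 1` and `|ξ₀| = exp c`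
(e.g. the pivot point and the tower direction `jE(((ϖσϖ)⁻¹)^i)·ξ_θ`, `c = 2i`, §6).  THEN for every `|V₀| ≤ 1`: `|κ₀ + jE V₀·ξ₀|·|jE ϖ^j (α − ρα)| = |jE ϖ|^b ⟺ |V₀| = 1`.
[cite: Serre1979, Ch. II §1] [cite: Flicker1998UnitaryFL, Prop. 7 p. 84] -/
theorem sphereClause_tower_iff (jE : E →+* M) (hjiso : ∀ a, Valued.v (jE a) = Valued.v a) {ϖ : E} (hϖ : Valued.v ϖ = exp (-1 : ℤ))
    (hU : Valued.v (α - ρ α) = 1) {j b c : ℕ} (hcj : b + c = j) (hc : 1 ≤ c)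
    {κ₀ ξ₀ : M} (hκ₀1 : Valued.v κ₀ = 1) (hξc : Valued.v ξ₀ = exp (c : ℤ)) {V₀ : E} (hV₀ : Valued.v V₀ ≤ 1) :
    Valued.v (κ₀ + jE V₀ * ξ₀) * Valued.v (jE ϖ ^ j * (α - ρ α)) = Valued.v (jE ϖ) ^ b ↔ Valued.v V₀ = 1 := by
  obtain ⟨hR, hb⟩ := radius_letters (ρ := ρ) jE hjiso hϖ hU j b
  have hcc : jE ϖ ^ j * (α - ρ α) ≠ 0 := (Valuation.ne_zero_iff Valued.v).1 (by rw [hR]; exact exp_ne_zero)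
  have hlt : Valued.v κ₀ < Valued.v ξ₀ := by
    rw [hκ₀1, hξc, ← exp_zero, exp_lt_exp]; exact_mod_cast hc
  have hξR : Valued.v ξ₀ * Valued.v (jE ϖ ^ j * (α - ρ α)) = Valued.v (jE ϖ) ^ b := by
    rw [hξc, hR, hb, ← exp_add]
    congr 1
    omega
  exact sphereClause_iff_v_eq_one_of_lt jE hjiso hcc hlt hξR hV₀

omit [Valued E ℤᵐ⁰] in
/-- **HEAD-T, FINSET FORM — `Rd.filter LIT = (Rd.filter (|·| = 1)).filter CLASS` ON A TOWER CELL.**  Frame of `sphereClause_iff_v_eq_one_of_lt`; a digit system `Rd` of INTEGRAL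
digits and any class predicate `C`.  THEN `Rd.filter (fun V ↦ SPHERE V ∧ C V) = (Rd.filter fun V ↦ |V| = 1).filter C` — the literal digits of a tower cell are the class digits
of the UNIT SHELL. [cite: Serre1979, Ch. II §1] [cite: Kottwitz1986BaseChangeUnits, §1 pp. 240–241] -/
theorem filter_sphere_and_eq_filter_shell [Valued E ℤᵐ⁰] (jE : E →+* M) (hjiso : ∀ a, Valued.v (jE a) = Valued.v a) {ϖ : E} {j b : ℕ}
    (hcc : jE ϖ ^ j * (α - ρ α) ≠ 0) {κ₀ ξ₀ : M} (hlt : Valued.v κ₀ < Valued.v ξ₀)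
    (hξR : Valued.v ξ₀ * Valued.v (jE ϖ ^ j * (α - ρ α)) = Valued.v (jE ϖ) ^ b)
    (Rd : Finset E) (hRd1 : ∀ V ∈ Rd, Valued.v V ≤ 1) (C : E → Prop) [DecidablePred C]
    [DecidablePred fun V => Valued.v (κ₀ + jE V * ξ₀) * Valued.v (jE ϖ ^ j * (α - ρ α)) = Valued.v (jE ϖ) ^ b ∧ C V]
    [DecidablePred fun V : E => Valued.v V = 1] :
    Rd.filter (fun V => Valued.v (κ₀ + jE V * ξ₀) * Valued.v (jE ϖ ^ j * (α - ρ α)) = Valued.v (jE ϖ) ^ b ∧ C V) =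
      (Rd.filter fun V => Valued.v V = 1).filter C := by
  rw [Finset.filter_filter]
  refine Finset.filter_congr fun V hV => ?_
  rw [sphereClause_iff_v_eq_one_of_lt jE hjiso hcc hlt hξR (hRd1 V hV)]

/-! ## §5 Parity and range of the cell index: `Θ`-fixed valuations are even -/

/-- **ODD CELLS CARRY NO POINT OF THE LINE; THE INDEX IS `j − b = 2n ≥ 0`.**  `|jE a| = |a|`, `|ϖ| = exp(−1)`, the `Θ`-datum on `M` (`IsRamifiedQuadraticDatum Θ (jE ϖ) d tE`
— `_hDM`; used: `Θ`-fixed non-zero elements have valuation in `exp(2ℤ)`), `|α − ρα| = 1`, `ρ` isometric.  THEN a `Θ`-fixed point `κ` of `ρ`-trace one satisfying the sphere clause of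
the cell `(j, b)` (`|κ|·|jE ϖ^j (α − ρα)| = |jE ϖ|^b`, e.g. the digit `κ̂(x₀)` of any member, or any literal digit `κ₀ + jE V₀ ξ₀`) forces `j = b + 2n` for some `n : ℕ`
(`|κ| = exp(j − b) = exp(2m)` and `1 ≤ |κ|` by ★ `one_le_v_of_trace_one`). [cite: Serre1979, Ch. II §1; Ch. V §2 Prop. 3 p. 81] [cite: Flicker1998UnitaryFL, Prop. 7 p. 84] -/
theorem exists_eq_add_two_mul_of_sphereClause (jE : E →+* M) (hjiso : ∀ a, Valued.v (jE a) = Valued.v a) {ϖ : E} (hϖ : Valued.v ϖ = exp (-1 : ℤ))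
    {d tE : ℕ} (hDM : IsRamifiedQuadraticDatum Θ (jE ϖ) d tE) (hU : Valued.v (α - ρ α) = 1)
    (hvρ : ∀ x, Valued.v (ρ x) = Valued.v x) {κ : M} (hκ : κ + ρ κ = 1) (hΘκ : Θ κ = κ) {j b : ℕ}
    (hsphere : Valued.v κ * Valued.v (jE ϖ ^ j * (α - ρ α)) = Valued.v (jE ϖ) ^ b) :
    ∃ n : ℕ, j = b + 2 * n := by
  obtain ⟨-, -, -, hKval, -⟩ := id hDM
  obtain ⟨hR, hb⟩ := radius_letters (ρ := ρ) jE hjiso hϖ hU j b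
  have hge : 1 ≤ Valued.v κ := one_le_v_of_trace_one hvρ hκ
  have hκ0 : κ ≠ 0 := fun h0 => by rw [h0, Valuation.map_zero] at hge; exact not_lt.2 hge zero_lt_one
  obtain ⟨m, hm⟩ := hKval κ hΘκ hκ0
  have hv : Valued.v κ = exp ((j : ℤ) - b) := by
    rw [hR, hb] at hsphere
    have h' : Valued.v κ = exp (-(b : ℤ)) / exp (-(j : ℤ)) := by rw [eq_div_iff exp_ne_zero]; exact hsphere
    rw [h', ← exp_sub]
    congr 1
    ring
  rw [hm] at hv hge
  rw [← exp_zero, exp_le_exp] at hge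
  rw [exp_inj] at hv
  obtain ⟨n, rfl⟩ := Int.eq_ofNat_of_zero_le (show (0 : ℤ) ≤ m by omega)
  exact ⟨n, by omega⟩

/-! ## §6 The lane-B pivot pair (member-free) and the tower directions -/

omit [Field E] [Valued E ℤᵐ⁰] in
/-- **THE PIVOT PAIR OF LANE B.**  `ρ` an isometric involution commuting with `Θ`; a `Θ`-fixed integral `θ₀` with `|θ₀ − ρθ₀| = 1` (★ `theta0_letters`: `θ₀ = αΘα` under `|α − ρα| = 1`,
`|α − Θα| < 1`, `|2| < 1`).  THEN with `κ_θ := −ρθ₀ ∕ (θ₀ − ρθ₀)` and `ξ_θ := (θ₀ − ρθ₀)⁻¹`: (a) `κ_θ + ρκ_θ = 1`, `Θκ_θ = κ_θ`, `|κ_θ| = 1`; (b) `ρξ_θ = −ξ_θ`, `Θξ_θ = ξ_θ`, `ξ_θ ≠ 0`,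
`|ξ_θ| = 1`; (c) for every `V`, LH4-p19's diagonal-cell coordinate `ŵ(V) = (V − ρθ₀) ∕ (θ₀ − ρθ₀)` (★ `hatw_add_map_hatw`) IS `κ_θ + V·ξ_θ` — so «`|κ_min| = 1`» in lane B and the two
lineages' coordinates agree on this pair. [cite: Serre1979, Ch. V §2 Prop. 3 p. 81] [cite: Flicker1998UnitaryFL, Prop. 7 p. 84] -/
theorem pivotPair_letters (hρρ : ∀ x, ρ (ρ x) = x) (hvρ : ∀ x, Valued.v (ρ x) = Valued.v x) (hΘρ : ∀ x, Θ (ρ x) = ρ (Θ x))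
    {θ₀ : M} (hΘθ₀ : Θ θ₀ = θ₀) (hθ1 : Valued.v θ₀ ≤ 1) (hθρ : Valued.v (θ₀ - ρ θ₀) = 1) :
    ((-ρ θ₀ / (θ₀ - ρ θ₀)) + ρ (-ρ θ₀ / (θ₀ - ρ θ₀)) = 1 ∧ Θ (-ρ θ₀ / (θ₀ - ρ θ₀)) = -ρ θ₀ / (θ₀ - ρ θ₀) ∧
        Valued.v (-ρ θ₀ / (θ₀ - ρ θ₀)) = 1) ∧
      (ρ (θ₀ - ρ θ₀)⁻¹ = -(θ₀ - ρ θ₀)⁻¹ ∧ Θ (θ₀ - ρ θ₀)⁻¹ = (θ₀ - ρ θ₀)⁻¹ ∧ (θ₀ - ρ θ₀)⁻¹ ≠ 0 ∧ Valued.v (θ₀ - ρ θ₀)⁻¹ = 1) ∧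
      ∀ V : M, (V - ρ θ₀) / (θ₀ - ρ θ₀) = -ρ θ₀ / (θ₀ - ρ θ₀) + V * (θ₀ - ρ θ₀)⁻¹ := by
  have hδ0 : θ₀ - ρ θ₀ ≠ 0 := fun h0 => by rw [h0, Valuation.map_zero] at hθρ; exact zero_ne_one hθρ
  have hρδ : ρ (θ₀ - ρ θ₀) = -(θ₀ - ρ θ₀) := by rw [map_sub, hρρ]; ring
  have hΘδ : Θ (θ₀ - ρ θ₀) = θ₀ - ρ θ₀ := by rw [map_sub, hΘρ, hΘθ₀]
  have hθv : Valued.v θ₀ = 1 := by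
    refine le_antisymm hθ1 ?_
    have h := Valuation.map_sub Valued.v θ₀ (ρ θ₀)
    rw [hθρ, hvρ, max_self] at h
    exact h
  refine ⟨⟨?_, ?_, ?_⟩, ⟨?_, ?_, inv_ne_zero hδ0, ?_⟩, fun V => ?_⟩
  · rw [map_div₀, map_neg, hρρ, hρδ]
    field_simp
    ring
  · rw [map_div₀, map_neg, hΘρ, hΘθ₀, hΘδ]
  · rw [map_div₀, Valuation.map_neg, hvρ, hθv, hθρ, div_one]
  · rw [map_inv₀, hρδ, inv_neg]
  · rw [map_inv₀, hΘδ]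
  · rw [map_inv₀, hθρ, inv_one]
  · field_simp
    ring

omit [Field E] [Valued E ℤᵐ⁰] in
/-- **THE PIVOT PAIR FROM THE RamK FRAME LETTERS** (`ρ`, `Θ` commuting isometric involutions, `|α| ≤ 1`, `|α − ρα| = 1` (`_hU`), `|α − Θα| < 1` (`_hτ`), `|2| < 1`): with `θ₀ := αΘα`
(★ `theta0_letters`) the conclusions of `pivotPair_letters` hold — a MEMBER-FREE reference pair `(κ_θ, ξ_θ)` of sizes `(1, 1)` on the line `{Tr_ρ = 1} ∩ Fix Θ`.
[cite: Serre1979, Ch. V §2 Prop. 3 p. 81] [cite: Flicker1998UnitaryFL, Prop. 7 p. 84] -/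
theorem pivotPair_of_frame (hρρ : ∀ x, ρ (ρ x) = x) (hvρ : ∀ x, Valued.v (ρ x) = Valued.v x) (hΘΘ : ∀ x, Θ (Θ x) = x)
    (hΘρ : ∀ x, Θ (ρ x) = ρ (Θ x)) (hvΘ : ∀ x, Valued.v (Θ x) = Valued.v x) (hα1 : Valued.v α ≤ 1) (hU : Valued.v (α - ρ α) = 1)
    (hτ : Valued.v (α - Θ α) < 1) (h2 : Valued.v (2 : M) < 1) :
    ((-ρ (α * Θ α) / (α * Θ α - ρ (α * Θ α))) + ρ (-ρ (α * Θ α) / (α * Θ α - ρ (α * Θ α))) = 1 ∧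
        Θ (-ρ (α * Θ α) / (α * Θ α - ρ (α * Θ α))) = -ρ (α * Θ α) / (α * Θ α - ρ (α * Θ α)) ∧
        Valued.v (-ρ (α * Θ α) / (α * Θ α - ρ (α * Θ α))) = 1) ∧
      (ρ (α * Θ α - ρ (α * Θ α))⁻¹ = -(α * Θ α - ρ (α * Θ α))⁻¹ ∧ Θ (α * Θ α - ρ (α * Θ α))⁻¹ = (α * Θ α - ρ (α * Θ α))⁻¹ ∧
        (α * Θ α - ρ (α * Θ α))⁻¹ ≠ 0 ∧ Valued.v (α * Θ α - ρ (α * Θ α))⁻¹ = 1) ∧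
      ∀ V : M, (V - ρ (α * Θ α)) / (α * Θ α - ρ (α * Θ α)) = -ρ (α * Θ α) / (α * Θ α - ρ (α * Θ α)) + V * (α * Θ α - ρ (α * Θ α))⁻¹ := by
  obtain ⟨hΘθ₀, hθ1, hθρ⟩ := theta0_letters (ρ := ρ) hvρ hΘΘ hvΘ hα1 hU hτ h2
  exact pivotPair_letters hρρ hvρ hΘρ hΘθ₀ hθ1 hθρ

/-- **THE TOWER DIRECTIONS.**  `σ` an isometric involution of `E` with `|ϖ| = exp(−1)`; `jE`-letters (`ρ ∘ jE = jE`, `Θ ∘ jE = jE ∘ σ`, `|jE a| = |a|`); a direction `ξ₀` with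
`ρξ₀ = −ξ₀`, `Θξ₀ = ξ₀ ≠ 0`.  THEN for every `i : ℕ`, with the `σ`-fixed scalar `s_i := ((ϖσϖ)⁻¹)^i` of size `exp(2i)`, the direction `ξ_i := jE s_i · ξ₀` has `ρξ_i = −ξ_i`,
`Θξ_i = ξ_i`, `ξ_i ≠ 0`, `|ξ_i| = exp(2i)·|ξ₀|` — over the unit pivot pair, `ξ_i` has the digit radius of the tower cell `j = b + 2i` (§2, §4). [cite: Serre1979, Ch. II §1; Ch. V §2 Prop. 3 p. 81] -/
theorem towerDirection_letters {σ : E →+* E} (hσσ : ∀ a, σ (σ a) = a) (hvσ : ∀ a, Valued.v (σ a) = Valued.v a)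
    {ϖ : E} (hϖ : Valued.v ϖ = exp (-1 : ℤ))
    (jE : E →+* M) (hρj : ∀ c, ρ (jE c) = jE c) (hΘj : ∀ c, Θ (jE c) = jE (σ c)) (hjiso : ∀ a, Valued.v (jE a) = Valued.v a)
    {ξ₀ : M} (hξ : ρ ξ₀ = -ξ₀) (hΘξ : Θ ξ₀ = ξ₀) (hξ0 : ξ₀ ≠ 0) (i : ℕ) :
    ρ (jE (((ϖ * σ ϖ)⁻¹) ^ i) * ξ₀) = -(jE (((ϖ * σ ϖ)⁻¹) ^ i) * ξ₀) ∧ Θ (jE (((ϖ * σ ϖ)⁻¹) ^ i) * ξ₀) = jE (((ϖ * σ ϖ)⁻¹) ^ i) * ξ₀ ∧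
      jE (((ϖ * σ ϖ)⁻¹) ^ i) * ξ₀ ≠ 0 ∧ Valued.v (jE (((ϖ * σ ϖ)⁻¹) ^ i) * ξ₀) = exp (2 * (i : ℤ)) * Valued.v ξ₀ := by
  have hvϖ0 : Valued.v ϖ ≠ 0 := by rw [hϖ]; exact exp_ne_zero
  have hϖ0 : ϖ ≠ 0 := fun h0 => by rw [h0, map_zero] at hvϖ0; exact hvϖ0 rfl
  have hσs : σ (((ϖ * σ ϖ)⁻¹) ^ i) = ((ϖ * σ ϖ)⁻¹) ^ i := by
    rw [map_pow, map_inv₀, map_mul, hσσ, mul_comm (σ ϖ) ϖ]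
  have hs0 : ((ϖ * σ ϖ)⁻¹) ^ i ≠ 0 := pow_ne_zero _ (inv_ne_zero (mul_ne_zero hϖ0 ((map_ne_zero σ).2 hϖ0)))
  have hsv : Valued.v (((ϖ * σ ϖ)⁻¹) ^ i) = exp (2 * (i : ℤ)) := by
    rw [Valuation.map_pow, map_inv₀, Valuation.map_mul, hvσ, hϖ, ← exp_add, ← exp_neg, ← exp_nsmul, nsmul_eq_mul]
    congr 1
    ring
  refine ⟨?_, ?_, mul_ne_zero ((map_ne_zero jE).2 hs0) hξ0, ?_⟩
  · rw [map_mul, hρj, hξ, mul_neg]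
  · rw [map_mul, hΘj, hσs, hΘξ]
  · rw [Valuation.map_mul, hjiso, hsv]

/-! ## §7 ONE chart for the whole row (K6-(e) ∕ ‹K6-(f)›: one `(κ₀, ξ₀, Rd)` with `|κ₀| = 1` and `|ξ₀|` the TOP radius; the cell index of a digit) -/

/-- **THE SPHERE CLAUSE IN ONE CHART — `max 1 (|V₀|·|ξ₀|) = exp(j − b)`.**  `ρ` isometric, `jE`-letters, `|ϖ| = exp(−1)`, `|α − ρα| = 1`; ONE reference pair for the row with
`κ₀ + ρκ₀ = 1`, `|κ₀| = 1`, `ρξ₀ = −ξ₀` (ANY size of `ξ₀`, e.g. the top tower's radius).  THEN for every digit `V₀` and every order `j`: the sphere clause of the cell `(j, b)` holds at `V₀`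
iff `max 1 (|V₀|·|ξ₀|) = exp(j − b)` — the cell index of the digit `κ₀ + jE V₀·ξ₀` is `log (max 1 (|V₀|·|ξ₀|))` (K6-(d)'s `cell : E → ℕ` for ★ `…CoreWindowOfDigitSums` §2′, read off §1).
[cite: Serre1979, Ch. II §1; Ch. V §2 Prop. 3 p. 81] [cite: Flicker1998UnitaryFL, Prop. 7 p. 84] -/
theorem sphereClause_iff_max_eq (hvρ : ∀ x, Valued.v (ρ x) = Valued.v x) (jE : E →+* M) (hρj : ∀ c, ρ (jE c) = jE c)
    (hjiso : ∀ a, Valued.v (jE a) = Valued.v a) {ϖ : E} (hϖ : Valued.v ϖ = exp (-1 : ℤ)) (hU : Valued.v (α - ρ α) = 1)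
    {κ₀ ξ₀ : M} (hκ₀ : κ₀ + ρ κ₀ = 1) (hκ₀1 : Valued.v κ₀ = 1) (hξ : ρ ξ₀ = -ξ₀) (V₀ : E) (j b : ℕ) :
    Valued.v (κ₀ + jE V₀ * ξ₀) * Valued.v (jE ϖ ^ j * (α - ρ α)) = Valued.v (jE ϖ) ^ b ↔
      max 1 (Valued.v V₀ * Valued.v ξ₀) = exp ((j : ℤ) - b) := by
  obtain ⟨hR, hb⟩ := radius_letters (ρ := ρ) jE hjiso hϖ hU j b
  rw [hR, hb, v_traceOne_add_map_mul_anti_eq_max hvρ jE hρj hjiso hκ₀ hκ₀1 hξ V₀,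
    show exp ((j : ℤ) - b) = exp (-(b : ℤ)) / exp (-(j : ℤ)) by rw [← exp_sub]; congr 1; ring, eq_div_iff exp_ne_zero]

/-- **ONE CHART, THE DIAGONAL CELL**: frame of `sphereClause_iff_max_eq`.  The sphere clause of `(b, b)` holds at `V₀` iff `|V₀|·|ξ₀| ≤ 1` — in the chart of the top radius
`|ξ₀| = exp 2N` the diagonal cell's digits are the BALL `|V₀| ≤ exp(−2N)`. [cite: Serre1979, Ch. II §1] [cite: Flicker1998UnitaryFL, Prop. 7 p. 84] -/
theorem sphereClause_oneChart_diag_iff (hvρ : ∀ x, Valued.v (ρ x) = Valued.v x) (jE : E →+* M) (hρj : ∀ c, ρ (jE c) = jE c)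
    (hjiso : ∀ a, Valued.v (jE a) = Valued.v a) {ϖ : E} (hϖ : Valued.v ϖ = exp (-1 : ℤ)) (hU : Valued.v (α - ρ α) = 1)
    {κ₀ ξ₀ : M} (hκ₀ : κ₀ + ρ κ₀ = 1) (hκ₀1 : Valued.v κ₀ = 1) (hξ : ρ ξ₀ = -ξ₀) (V₀ : E) (b : ℕ) :
    Valued.v (κ₀ + jE V₀ * ξ₀) * Valued.v (jE ϖ ^ b * (α - ρ α)) = Valued.v (jE ϖ) ^ b ↔ Valued.v V₀ * Valued.v ξ₀ ≤ 1 := by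
  rw [sphereClause_iff_max_eq hvρ jE hρj hjiso hϖ hU hκ₀ hκ₀1 hξ V₀ b b, sub_self, exp_zero, max_eq_left_iff]

/-- **ONE CHART, A TOWER CELL `b < j`**: frame of `sphereClause_iff_max_eq`.  The sphere clause of `(j, b)` holds at `V₀` iff `|V₀|·|ξ₀| = exp(j − b)` — in the chart of the top radius
`|ξ₀| = exp 2N` the cell `j = b + 2i` (`1 ≤ i ≤ N`) is the SHELL `|V₀| = exp(2i − 2N)`. [cite: Serre1979, Ch. II §1] [cite: Flicker1998UnitaryFL, Prop. 7 p. 84] -/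
theorem sphereClause_oneChart_tower_iff (hvρ : ∀ x, Valued.v (ρ x) = Valued.v x) (jE : E →+* M) (hρj : ∀ c, ρ (jE c) = jE c)
    (hjiso : ∀ a, Valued.v (jE a) = Valued.v a) {ϖ : E} (hϖ : Valued.v ϖ = exp (-1 : ℤ)) (hU : Valued.v (α - ρ α) = 1)
    {κ₀ ξ₀ : M} (hκ₀ : κ₀ + ρ κ₀ = 1) (hκ₀1 : Valued.v κ₀ = 1) (hξ : ρ ξ₀ = -ξ₀) (V₀ : E) {j b : ℕ} (hbj : b < j) :
    Valued.v (κ₀ + jE V₀ * ξ₀) * Valued.v (jE ϖ ^ j * (α - ρ α)) = Valued.v (jE ϖ) ^ b ↔ Valued.v V₀ * Valued.v ξ₀ = exp ((j : ℤ) - b) := by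
  rw [sphereClause_iff_max_eq hvρ jE hρj hjiso hϖ hU hκ₀ hκ₀1 hξ V₀ j b]
  have hgt : (1 : ℤᵐ⁰) < exp ((j : ℤ) - b) := by rw [← exp_zero, exp_lt_exp]; omega
  constructor
  · intro h
    rcases le_total 1 (Valued.v V₀ * Valued.v ξ₀) with hle | hle
    · rwa [max_eq_right hle] at h
    · rw [max_eq_left hle] at h; exact absurd h hgt.ne
  · intro h
    rw [h, max_eq_right hgt.le]

omit [Valued E ℤᵐ⁰] in
/-- **THE CELLS OF ONE CHART ARE DISJOINT**: `|jE a| = |a|`, `|ϖ| = exp(−1)`, `|α − ρα| = 1`.  If one point `κ` satisfies the sphere clauses of `(j, b)` and of `(j′, b)` then `j = j′`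
(`|κ| ≠ 0` and `exp(−j) = exp(−j′)`). [cite: Serre1979, Ch. II §1] -/
theorem eq_of_sphereClause_of_sphereClause [Valued E ℤᵐ⁰] (jE : E →+* M) (hjiso : ∀ a, Valued.v (jE a) = Valued.v a) {ϖ : E} (hϖ : Valued.v ϖ = exp (-1 : ℤ))
    (hU : Valued.v (α - ρ α) = 1) {κ : M} {j j' b : ℕ}
    (hj : Valued.v κ * Valued.v (jE ϖ ^ j * (α - ρ α)) = Valued.v (jE ϖ) ^ b)
    (hj' : Valued.v κ * Valued.v (jE ϖ ^ j' * (α - ρ α)) = Valued.v (jE ϖ) ^ b) : j = j' := by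
  obtain ⟨hR, hb⟩ := radius_letters (ρ := ρ) jE hjiso hϖ hU j b
  rw [hR, hb] at hj
  rw [(radius_letters (ρ := ρ) jE hjiso hϖ hU j' b).1, hb] at hj'
  have hκ0 : Valued.v κ ≠ 0 := fun h0 => by rw [h0, zero_mul] at hj; exact exp_ne_zero hj.symm
  have h := hj.trans hj'.symm
  rw [mul_right_inj' hκ0, exp_inj] at h
  omega

/-- **THE CELLS OF ONE CHART COVER THE DIGITS (window `0 … N`)**: `ρ` isometric, `jE`-letters, the `σ`-datum on `E` (`IsRamifiedQuadraticDatum σ ϖ d tE` — used: `|ϖ| = exp(−1)` and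
«`σ`-fixed non-zero elements have valuation in `exp(2ℤ)`»), `|α − ρα| = 1`; ONE reference pair with `κ₀ + ρκ₀ = 1`, `|κ₀| = 1`, `ρξ₀ = −ξ₀` and `|ξ₀| = exp 2N` (the top tower's radius).
THEN every `σ`-fixed integral digit `V₀` lies on the sphere of exactly one (by `eq_of_sphereClause_of_sphereClause`) cell `(b + 2i, b)` with `i ≤ N`: `i = 0` on the ball
`|V₀| ≤ exp(−2N)`, `i = N − m` on the shell `|V₀| = exp(−2m)`, `m < N`. [cite: Serre1979, Ch. II §1; Ch. V §2 Prop. 3 p. 81] [cite: Flicker1998UnitaryFL, Prop. 7 p. 84] -/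
theorem exists_sphereClause_of_oneChart (hvρ : ∀ x, Valued.v (ρ x) = Valued.v x) {σ : E →+* E} {ϖ : E} {d tE : ℕ} (hD : IsRamifiedQuadraticDatum σ ϖ d tE)
    (jE : E →+* M) (hρj : ∀ c, ρ (jE c) = jE c) (hjiso : ∀ a, Valued.v (jE a) = Valued.v a) (hU : Valued.v (α - ρ α) = 1)
    {κ₀ ξ₀ : M} (hκ₀ : κ₀ + ρ κ₀ = 1) (hκ₀1 : Valued.v κ₀ = 1) (hξ : ρ ξ₀ = -ξ₀) {N : ℕ} (hξN : Valued.v ξ₀ = exp (2 * (N : ℤ)))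
    {V₀ : E} (hσV₀ : σ V₀ = V₀) (hV₀ : Valued.v V₀ ≤ 1) (b : ℕ) :
    ∃ i : ℕ, i ≤ N ∧ Valued.v (κ₀ + jE V₀ * ξ₀) * Valued.v (jE ϖ ^ (b + 2 * i) * (α - ρ α)) = Valued.v (jE ϖ) ^ b := by
  obtain ⟨-, -, hϖ, hEval, -⟩ := id hD
  have key : ∀ i : ℕ, max 1 (Valued.v V₀ * Valued.v ξ₀) = exp (2 * (i : ℤ)) →
      Valued.v (κ₀ + jE V₀ * ξ₀) * Valued.v (jE ϖ ^ (b + 2 * i) * (α - ρ α)) = Valued.v (jE ϖ) ^ b := fun i hi => by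
    rw [sphereClause_iff_max_eq hvρ jE hρj hjiso hϖ hU hκ₀ hκ₀1 hξ V₀ (b + 2 * i) b, hi]
    congr 1
    push_cast
    ring
  by_cases hV0 : V₀ = 0
  · refine ⟨0, Nat.zero_le _, key 0 ?_⟩
    rw [hV0, Valuation.map_zero, zero_mul, max_eq_left zero_le]
    simp
  obtain ⟨n, hn⟩ := hEval V₀ hσV₀ hV0
  have hn0 : n ≤ 0 := by
    rw [hn, ← exp_zero, exp_le_exp] at hV₀; omega
  have hprod : Valued.v V₀ * Valued.v ξ₀ = exp (2 * (n + N)) := by rw [hn, hξN, ← exp_add]; congr 1; ring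
  by_cases hle : n + (N : ℤ) ≤ 0
  · refine ⟨0, Nat.zero_le _, key 0 ?_⟩
    rw [hprod, max_eq_left (by rw [← exp_zero, exp_le_exp]; omega)]
    simp
  · obtain ⟨i, hi⟩ := Int.eq_ofNat_of_zero_le (show (0 : ℤ) ≤ n + N by omega)
    refine ⟨i, by omega, key i ?_⟩
    rw [hprod, hi, max_eq_right]
    rw [← exp_zero, exp_le_exp]; omega

end Summit.HodgeConjecture.HodgeConjecture.Cruxes.H413.F0P3cDyRamRowCellDigitShellDictionary

end
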